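import Mathlib
import HarnessLib
import Literature.MathematicalPhysics.StatisticalMechanics.WeightTower

/-!
# Factorisation and integration property of the weight tower (Adams–Buchholz–Kotecký–Müller,
# Lemma 7.6 (i), Lemma 7.7 (ii); Theorem 7.1 (w3), (w4), (w7))

Continuation of `WeightTower.lean` (the forms `A_k^X = W.form k X`, `A_{k:k+1}^X = W.midForm k X`
of [ABKM19] (7.5) for abstract data `W : WeightData Λ`).  Two further structural facts of Theorem 7.1
are derived from hypotheses on the data:

* **Additivity over separated polymers** (Lemma 7.6 (i) ⇒ Theorem 7.1 (w3), (w4)).  The mechanism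
  is `A_k^X 𝒞 A_k^Y = 0` ((7.58)): a local symmetric form `A_Y` (`IsGradLocal A_Y S_Y`) maps every
  field to a zero-sum field supported in `S_Y`, a covariance whose kernel is constant across the
  distance from `S_Y` to `S_X` (`Matrix.Separates C S_X S_Y`) maps that to a field constant on `S_X`,
  which `A_X` kills (`IsGradLocal.mul_mul_eq_zero`).  With the tree's finite-range additivity of
  `nextForm` (`nextForm_add_of_mul_mul_eq_zero`) an induction along the tower gives
  `WeightData.form_add` / `midForm_add` (`A_k^{X∪Y} = A_k^X + A_k^Y`, `A_{k:k+1}^{X∪Y} = …`) under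
  `WeightData.Additive`, hence the factorisation of the weights `weight_union`, `midWeight_union`.
* **Integration property** (Lemma 7.7 (ii) ⇒ Theorem 7.1 (w7), shape): if the dominating sequence
  has a MARGIN `√C_k D_k √C_k ⪯ θ·1`, `θ < 1`, then
  `∫ w_k^X(φ + ψ) N(0, C_k)(dψ) ≤ (1−θ)^{−tr(√C_k A_k^X √C_k)/(2θ)} w_{k:k+1}^X(φ)`
  (`WeightData.integral_weight_add_le`), the exponent being monotone in the form
  (`trace_sqrt_mul_sqrt_mono`), so that any local dominator of `A_k^X` bounds it (Lemma 7.7 (i)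
  reduces the constant to `A_𝒫^{|X|_k}` this way, (7.72)).

Everything is proved; no named fact.  What is NOT here: the strong weights `W_k^X` and (w5), (w6),
(w8), (w9); the verification of the hypotheses for the concrete data of [ABKM19].

## References
* S. Adams, S. Buchholz, R. Kotecký, S. Müller, arXiv:1910.13564, Lemma 7.6 (i) with (7.57)–(7.58),
  Lemma 7.7, Theorem 7.1 (w3), (w4), (w7) [AdamsBuchholzKoteckyMuller2019].
-/

noncomputable section

open Matrix MeasureTheory ProbabilityTheory WithLp
open scoped Matrix MatrixOrder

namespace Literature.MathematicalPhysics.StatisticalMechanics.GradientRG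

open Literature.Analysis.Matrix (posSemidef_cfcSqrt conjTranspose_cfcSqrt)

variable {Λ : Type*} [Fintype Λ] [DecidableEq Λ]

/-! ## The mechanism `A_X 𝒞 A_Y = 0` ((7.58)) -/

/-- **The covariance separates `S_X` from `S_Y`**: every zero-sum field supported in `S_Y` is
mapped by `C` to a field that is constant on `S_X` — for a translation-invariant kernel constant
beyond its range ([ABKM19] (6.7)/(7.58): "the kernel `𝒞(x)` of `C` is constant for
`|x|_∞ ≥ L^{k+1}/2`") this holds as soon as `dist(S_X, S_Y)` exceeds the range.
[cite: AdamsBuchholzKoteckyMuller2019, Lemma 7.6 (i) (proof, (7.58))] -/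
def _root_.Matrix.Separates (C : Matrix Λ Λ ℝ) (S_X S_Y : Finset Λ) : Prop :=
  ∀ v : Λ → ℝ, (∀ x, x ∉ S_Y → v x = 0) → ∑ x, v x = 0 → ∃ c : ℝ, ∀ x ∈ S_X, (C *ᵥ v) x = c

namespace IsGradLocal

omit [DecidableEq Λ] in
/-- A symmetric local form produces fields SUPPORTED in its locality set.
[cite: AdamsBuchholzKoteckyMuller2019, Lemma 7.6 (i) (proof: supp(A_k^Y φ) ⊆ Y^{++})] -/
theorem mulVec_apply_eq_zero {A : Matrix Λ Λ ℝ} {S : Finset Λ} (hA : IsGradLocal A S)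
    (hAs : A.IsSymm) (φ : Λ → ℝ) {x : Λ} (hx : x ∉ S) : (A *ᵥ φ) x = 0 := by
  classical
  -- `(Aφ)(x) = e_x · Aφ = (A e_x) · φ` and `e_x` vanishes on `S`
  have hAt : Aᵀ = A := hAs
  have h1 : (A *ᵥ φ) x = (Pi.single x (1 : ℝ)) ⬝ᵥ (A *ᵥ φ) := by
    rw [dotProduct_comm, dotProduct_single_one]
  have h2 : A *ᵥ (Pi.single x (1 : ℝ)) = 0 :=
    hA.mulVec_eq_zero_of_forall_mem fun y hy => by
      rw [Pi.single_apply, if_neg]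
      rintro rfl
      exact hx hy
  rw [h1, Matrix.dotProduct_mulVec, ← Matrix.mulVec_transpose, hAt, h2, zero_dotProduct]

omit [DecidableEq Λ] in
/-- A symmetric local form produces ZERO-SUM fields.
[cite: AdamsBuchholzKoteckyMuller2019, Lemma 7.6 (i) (proof)] -/
theorem sum_mulVec_eq_zero {A : Matrix Λ Λ ℝ} {S : Finset Λ} (hA : IsGradLocal A S)
    (hAs : A.IsSymm) (φ : Λ → ℝ) : ∑ x, (A *ᵥ φ) x = 0 := by
  have hAt : Aᵀ = A := hAs
  have h1 : ∑ x, (A *ᵥ φ) x = (fun _ => (1 : ℝ)) ⬝ᵥ (A *ᵥ φ) := by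
    simp [dotProduct]
  rw [h1, Matrix.dotProduct_mulVec, ← Matrix.mulVec_transpose, hAt, hA.mulVec_const, zero_dotProduct]

omit [DecidableEq Λ] in
/-- **`A_X 𝒞 A_Y = 0`** ([ABKM19] (7.58)): for symmetric forms local on `S_X`, `S_Y` and a covariance
separating `S_X` from `S_Y`. [cite: AdamsBuchholzKoteckyMuller2019, Lemma 7.6 (i) (7.58)] -/
theorem mul_mul_eq_zero {A_X A_Y C : Matrix Λ Λ ℝ} {S_X S_Y : Finset Λ} (hX : IsGradLocal A_X S_X)
    (hY : IsGradLocal A_Y S_Y) (hYs : A_Y.IsSymm) (hC : C.Separates S_X S_Y) :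
    A_X * C * A_Y = 0 := by
  classical
  have hv : ∀ φ : Λ → ℝ, (A_X * C * A_Y) *ᵥ φ = 0 := by
    intro φ
    obtain ⟨c, hc⟩ := hC (A_Y *ᵥ φ) (fun x hx => hY.mulVec_apply_eq_zero hYs φ hx)
      (hY.sum_mulVec_eq_zero hYs φ)
    rw [← Matrix.mulVec_mulVec, ← Matrix.mulVec_mulVec]
    exact hX _ fun x hx y hy => by rw [hc x hx, hc y hy]
  ext i j
  have := congrFun (hv (Pi.single j 1)) i
  simpa [Matrix.mulVec_single_one] using this

end IsGradLocal

/-! ## Additivity along the tower (Lemma 7.6 (i), Theorem 7.1 (w3), (w4)) -/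

namespace WeightData

variable {W : WeightData Λ}

/-- **Additive data** relative to two separation relations: `SepF k X Y` ("strictly disjoint
`k`-polymers", for `A_k`) and `SepM k X Y` ("`dist(X,Y) ≥ ¾L^{k+1}`", for `A_{k:k+1}`): the seeds and
added forms are additive over `SepF`-separated sets, the enlargement is compatible with unions and
maps `SepF`-separated sets of scale `k+1` to `SepM`-separated sets of scale `k` ((7.56)),
`SepM`-separation implies `SepF`-separation, and the step covariance separates the locality sets of
`SepM`-separated sets ((7.58)). [cite: AdamsBuchholzKoteckyMuller2019, Lemma 7.6 (i)] -/
structure Additive (nb : ℕ → Finset Λ → Finset Λ) (SepF SepM : ℕ → Finset Λ → Finset Λ → Prop) :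
    Prop where
  /-- `A_0^{X∪Y} = A_0^X + A_0^Y` -/
  seed_add : ∀ X Y, SepF 0 X Y → W.seed (X ∪ Y) = W.seed X + W.seed Y
  /-- `M_k^{X∪Y} = M_k^X + M_k^Y` -/
  pert_add : ∀ k X Y, SepF k X Y → W.pert k (X ∪ Y) = W.pert k X + W.pert k Y
  /-- `(X ∪ Y)* = X* ∪ Y*` -/
  enl_union : ∀ k X Y, SepF k X Y → W.enl k (X ∪ Y) = W.enl k X ∪ W.enl k Y
  /-- strictly disjoint at scale `k+1` ⇒ stars separated at scale `k` -/
  enl_sep : ∀ k X Y, SepF (k + 1) X Y → SepM k (W.enl (k + 1) X) (W.enl (k + 1) Y)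
  /-- `SepM k` refines `SepF k` -/
  sepF_of_sepM : ∀ k X Y, SepM k X Y → SepF k X Y
  /-- finite range: the step covariance separates the locality sets -/
  cov_separates : ∀ k X Y, SepM k X Y → (W.cov k).Separates (nb k X) (nb k Y)
  /-- the step covariances are non-negative -/
  cov_posSemidef : ∀ k, (W.cov k).PosSemidef

/-- Subcriticality makes the determinant of the residual form a unit (plumbing). [folklore] -/
private theorem isUnit_det_of_posDef {R : Matrix Λ Λ ℝ} (h : R.PosDef) : IsUnit R.det :=
  (Matrix.isUnit_iff_isUnit_det R).1 h.isUnit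

/-- **Lemma 7.6 (i) along the tower**: `A_k^{X∪Y} = A_k^X + A_k^Y` for `SepF`-separated and
`A_{k:k+1}^{X∪Y} = A_{k:k+1}^X + A_{k:k+1}^Y` for `SepM`-separated sets.
[cite: AdamsBuchholzKoteckyMuller2019, Lemma 7.6 (i)] -/
theorem form_add_and_midForm_add {D : ℕ → Matrix Λ Λ ℝ} (hD : W.Dominated D)
    {nb : ℕ → Finset Λ → Finset Λ} (hL : W.Local nb) {SepF SepM : ℕ → Finset Λ → Finset Λ → Prop}
    (hA : W.Additive nb SepF SepM) :
    ∀ k, (∀ X Y, SepF k X Y → W.form k (X ∪ Y) = W.form k X + W.form k Y) ∧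
      (∀ X Y, SepM k X Y → W.midForm k (X ∪ Y) = W.midForm k X + W.midForm k Y) := by
  -- the mid-form step from the form step, at any scale
  have hmid : ∀ k, (∀ X Y, SepF k X Y → W.form k (X ∪ Y) = W.form k X + W.form k Y) →
      ∀ X Y, SepM k X Y → W.midForm k (X ∪ Y) = W.midForm k X + W.midForm k Y := by
    intro k hk X Y hXY
    have hXYf := hk X Y (hA.sepF_of_sepM k X Y hXY)
    have hzero : W.form k X * W.cov k * W.form k Y = 0 :=
      (form_isGradLocal hL k X).mul_mul_eq_zero (form_isGradLocal hL k Y) (form_isSymm hD k Y)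
        (hA.cov_separates k X Y hXY)
    have hsum := form_subcritical hD k (X ∪ Y)
    rw [hXYf] at hsum
    rw [midForm, midForm, midForm, hXYf]
    exact nextForm_add_of_mul_mul_eq_zero (hA.cov_posSemidef k) (form_isSymm hD k X)
      (form_isSymm hD k Y) hzero (isUnit_det_of_posDef (form_subcritical hD k X))
      (isUnit_det_of_posDef (form_subcritical hD k Y)) (isUnit_det_of_posDef hsum)
  intro k
  induction k with
  | zero => exact ⟨fun X Y h => hA.seed_add X Y h, hmid 0 fun X Y h => hA.seed_add X Y h⟩
  | succ k ih =>
    have hform : ∀ X Y, SepF (k + 1) X Y →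
        W.form (k + 1) (X ∪ Y) = W.form (k + 1) X + W.form (k + 1) Y := by
      intro X Y hXY
      rw [form_succ, form_succ, form_succ, hA.enl_union (k + 1) X Y hXY,
        ih.2 _ _ (hA.enl_sep k X Y hXY), hA.pert_add (k + 1) X Y hXY]
      abel
    exact ⟨hform, hmid (k + 1) hform⟩

/-- **`A_k^{X∪Y} = A_k^X + A_k^Y`** for strictly disjoint polymers ((7.51)).
[cite: AdamsBuchholzKoteckyMuller2019, Lemma 7.6 (i) (7.51)] -/
theorem form_add {D : ℕ → Matrix Λ Λ ℝ} (hD : W.Dominated D) {nb : ℕ → Finset Λ → Finset Λ}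
    (hL : W.Local nb) {SepF SepM : ℕ → Finset Λ → Finset Λ → Prop} (hA : W.Additive nb SepF SepM)
    {k : ℕ} {X Y : Finset Λ} (h : SepF k X Y) : W.form k (X ∪ Y) = W.form k X + W.form k Y :=
  (form_add_and_midForm_add hD hL hA k).1 X Y h

/-- **`A_{k:k+1}^{X∪Y} = A_{k:k+1}^X + A_{k:k+1}^Y`** for `¾L^{k+1}`-separated polymers ((7.52)).
[cite: AdamsBuchholzKoteckyMuller2019, Lemma 7.6 (i) (7.52)] -/
theorem midForm_add {D : ℕ → Matrix Λ Λ ℝ} (hD : W.Dominated D) {nb : ℕ → Finset Λ → Finset Λ}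
    (hL : W.Local nb) {SepF SepM : ℕ → Finset Λ → Finset Λ → Prop} (hA : W.Additive nb SepF SepM)
    {k : ℕ} {X Y : Finset Λ} (h : SepM k X Y) :
    W.midForm k (X ∪ Y) = W.midForm k X + W.midForm k Y :=
  (form_add_and_midForm_add hD hL hA k).2 X Y h

/-- **Theorem 7.1 (w3)**: `w_k^{X∪Y} = w_k^X w_k^Y` for strictly disjoint polymers.
[cite: AdamsBuchholzKoteckyMuller2019, Theorem 7.1 (w3)] -/
theorem weight_union {D : ℕ → Matrix Λ Λ ℝ} (hD : W.Dominated D) {nb : ℕ → Finset Λ → Finset Λ}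
    (hL : W.Local nb) {SepF SepM : ℕ → Finset Λ → Finset Λ → Prop} (hA : W.Additive nb SepF SepM)
    {k : ℕ} {X Y : Finset Λ} (h : SepF k X Y) (φ : Λ → ℝ) :
    W.weight k (X ∪ Y) φ = W.weight k X φ * W.weight k Y φ := by
  rw [weight, weight, weight, form_add hD hL hA h, Matrix.add_mulVec, dotProduct_add, mul_add,
    Real.exp_add]

/-- **Theorem 7.1 (w4)**: `w_{k:k+1}^{X∪Y} = w_{k:k+1}^X w_{k:k+1}^Y` for `¾L^{k+1}`-separated polymers.
[cite: AdamsBuchholzKoteckyMuller2019, Theorem 7.1 (w4)] -/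
theorem midWeight_union {D : ℕ → Matrix Λ Λ ℝ} (hD : W.Dominated D)
    {nb : ℕ → Finset Λ → Finset Λ} (hL : W.Local nb) {SepF SepM : ℕ → Finset Λ → Finset Λ → Prop}
    (hA : W.Additive nb SepF SepM) {k : ℕ} {X Y : Finset Λ} (h : SepM k X Y) (φ : Λ → ℝ) :
    W.midWeight k (X ∪ Y) φ = W.midWeight k X φ * W.midWeight k Y φ := by
  rw [midWeight, midWeight, midWeight, midForm_add hD hL hA h, Matrix.add_mulVec, dotProduct_add,
    mul_add, Real.exp_add]

/-! ## Integration property (Lemma 7.7 (ii), Theorem 7.1 (w7), shape) -/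

/-- The exponent of the integration constant is monotone in the form:
`A ⪯ B ⇒ tr(√C A √C) ≤ tr(√C B √C)` (used with a local dominator `B = λ⁻¹ m_X M_k m_X`, (7.72)).
[cite: AdamsBuchholzKoteckyMuller2019, Lemma 7.7 (i) (7.72)] -/
theorem trace_sqrt_mul_sqrt_mono {A B C : Matrix Λ Λ ℝ} (hAB : (B - A).PosSemidef) :
    (CFC.sqrt C * A * CFC.sqrt C).trace ≤ (CFC.sqrt C * B * CFC.sqrt C).trace := by
  have hpsd : ((CFC.sqrt C)ᴴ * (B - A) * CFC.sqrt C).PosSemidef := hAB.conjTranspose_mul_mul_same _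
  rw [conjTranspose_cfcSqrt, Matrix.mul_sub, Matrix.sub_mul] at hpsd
  have := hpsd.trace_nonneg
  rw [Matrix.trace_sub] at this
  linarith

/-- A margin for the dominator is a margin for every dominated form:
`A ⪯ D`, `θ·1 − √C D √C ⪰ 0 ⇒ θ·1 − √C A √C ⪰ 0`. [cite: AdamsBuchholzKoteckyMuller2019, Lemma 7.7 (7.71)] -/
theorem posSemidef_smul_one_sub_sqrt_mul_sqrt_anti {A D C : Matrix Λ Λ ℝ} {θ : ℝ}
    (hAD : (D - A).PosSemidef)
    (hθ : (θ • (1 : Matrix Λ Λ ℝ) - CFC.sqrt C * D * CFC.sqrt C).PosSemidef) :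
    (θ • (1 : Matrix Λ Λ ℝ) - CFC.sqrt C * A * CFC.sqrt C).PosSemidef := by
  have hpsd : ((CFC.sqrt C)ᴴ * (D - A) * CFC.sqrt C).PosSemidef := hAD.conjTranspose_mul_mul_same _
  rw [conjTranspose_cfcSqrt] at hpsd
  have := hθ.add hpsd
  convert this using 1
  rw [Matrix.mul_sub, Matrix.sub_mul]
  abel

/-- `√C A √C ⪰ 0` for `A ⪰ 0`. [cite: AdamsBuchholzKoteckyMuller2019, Lemma 7.7 (7.71)] -/
theorem posSemidef_sqrt_mul_sqrt {A : Matrix Λ Λ ℝ} (hA : A.PosSemidef) (C : Matrix Λ Λ ℝ) :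
    (CFC.sqrt C * A * CFC.sqrt C).PosSemidef := by
  have hpsd : ((CFC.sqrt C)ᴴ * A * CFC.sqrt C).PosSemidef := hA.conjTranspose_mul_mul_same _
  rwa [conjTranspose_cfcSqrt] at hpsd

/-- **Theorem 7.1 (w7), shape** ([ABKM19] Lemma 7.7 (ii) with the determinant bound of Lemma 7.7 (i)
left as the trace exponent): if the dominating sequence has the margin `√C_k D_k √C_k ⪯ θ·1`,
`0 < θ < 1`, then for every polymer `X` and field `φ`
`∫ w_k^X(φ + ψ) N(0,C_k)(dψ) ≤ (1−θ)^{−tr(√C_k A_k^X √C_k)/(2θ)} · w_{k:k+1}^X(φ)`.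
[cite: AdamsBuchholzKoteckyMuller2019, Lemma 7.7 (ii)] -/
theorem integral_weight_add_le {D : ℕ → Matrix Λ Λ ℝ} (hD : W.Dominated D) {k : ℕ} {θ : ℝ}
    (hθ0 : 0 < θ) (hθ1 : θ < 1)
    (hmargin : (θ • (1 : Matrix Λ Λ ℝ) - CFC.sqrt (W.cov k) * D k * CFC.sqrt (W.cov k)).PosSemidef)
    (X : Finset Λ) (φ : Λ → ℝ) :
    ∫ ψ, W.weight k X (φ + ofLp ψ) ∂(multivariateGaussian 0 (W.cov k)) ≤
      (1 - θ) ^ (-((CFC.sqrt (W.cov k) * W.form k X * CFC.sqrt (W.cov k)).trace / (2 * θ))) *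
        W.midWeight k X φ := by
  simp only [weight, midWeight, midForm]
  exact integral_exp_half_quadForm_shift_le (W.cov k) (form_isSymm hD k X) hθ0 hθ1
    (posSemidef_sqrt_mul_sqrt (form_posSemidef hD k X) _)
    (posSemidef_smul_one_sub_sqrt_mul_sqrt_anti (form_le hD k X) hmargin) φ

/-- **Theorem 7.1 (w7), shape, with a dominator in the exponent**: if moreover `A_k^X ⪯ B` then
`∫ w_k^X(φ + ψ) N(0,C_k)(dψ) ≤ (1−θ)^{−tr(√C_k B √C_k)/(2θ)} · w_{k:k+1}^X(φ)` — with
`tr(√C_k B √C_k) ≤ c|X|_k` for a local dominator this is (w7) with `A_𝒫 = 2(1−θ)^{−c/(2θ)}`.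
[cite: AdamsBuchholzKoteckyMuller2019, Theorem 7.1 (w7)] -/
theorem integral_weight_add_le_of_le {D : ℕ → Matrix Λ Λ ℝ} (hD : W.Dominated D) {k : ℕ} {θ : ℝ}
    (hθ0 : 0 < θ) (hθ1 : θ < 1)
    (hmargin : (θ • (1 : Matrix Λ Λ ℝ) - CFC.sqrt (W.cov k) * D k * CFC.sqrt (W.cov k)).PosSemidef)
    {X : Finset Λ} {B : Matrix Λ Λ ℝ} (hB : (B - W.form k X).PosSemidef) (φ : Λ → ℝ) :
    ∫ ψ, W.weight k X (φ + ofLp ψ) ∂(multivariateGaussian 0 (W.cov k)) ≤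
      (1 - θ) ^ (-((CFC.sqrt (W.cov k) * B * CFC.sqrt (W.cov k)).trace / (2 * θ))) *
        W.midWeight k X φ := by
  refine (integral_weight_add_le hD hθ0 hθ1 hmargin X φ).trans
    (mul_le_mul_of_nonneg_right ?_ (midWeight_pos _ _ _).le)
  -- `(1−θ)^{−a/(2θ)}` is monotone in `a` since `1 − θ < 1`
  have h1 : 0 < 1 - θ := by linarith
  refine Real.rpow_le_rpow_of_exponent_ge h1 (by linarith) ?_
  have := trace_sqrt_mul_sqrt_mono (C := W.cov k) hB
  have h2θ : 0 < 2 * θ := by linarith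
  exact neg_le_neg (div_le_div_of_nonneg_right this h2θ.le)

end WeightData

end Literature.MathematicalPhysics.StatisticalMechanics.GradientRG

end
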